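import Literature.NumberTheory.Rogawski1990.ArchSplitTorusShell          -- ★ (part 1): the split torus `G_γ`, `d_τ`, `measure_chi_Icc_eq`∕`_lt_top`∕`_ne_zero`; brings ★ p848650∕678 `archPlaneLiftUnitary`, `measurable_…`, `iwasawaMeasure_le_haarSL2pm`
import Literature.MeasureTheory.Group.SL2HyperbolicOrbitMeasure             -- ★ p848769 (engine): `quotientMeasure_le_lintegral_inv_of_one_le`, `haarSL2pm_hsConjCone_slab_le`, `yOf`
import HarnessLib

/-!
# The quotient volume of a SPLIT regular orbit Hilbert–Schmidt ball in `U(Φ₂)(ℂ) ≅ U(1,1)` grows like `√R`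
# (head (ii) of DEAL #11 «(VOL-split-measure)», line LH3∕LH2 (VOL) kit; Beuzart-Plessis 2020 §1.2, §1.8)

Topic `NumberTheory/Rogawski1990`; namespace `Literature.NumberTheory.Rogawski1990`.  THEOREMS ONLY (no `def`, no instance, no notation, no axiom, no named fact,
no `sorry`).  Cell `pub/hodgecm-mathlib`, crux H413 (`stmt-HodgeConjecture-24833`), F0∕P3c line LH3 kit, DEAL #11 of LH3-plan (g0) (2026-09-02T03:24:33Z ∕ 03:28:17Z:
«HEAD (ii): an UPPER-BOUND unfolding `quotientMeasure A (tA) _ ν {x̄ ∣ P x̄ ≤ R} ≤ C_γ · √R` for split regular `γ`, `A` = the split torus, any Haar `ν`, on the (T1)-lift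
carrier; consume (T2e) by name or as a hypothesis»; seat LH2-p04 (g2)).

THE MATHEMATICS.  `G = U(Φ₂)(ℂ) ≤ GL₂(ℂ)` (`Φ₂ = antidiag(1,1)`, ★ `unitaryGroupOfForm (starRingEnd ℂ) Φ₂`), `γ ∈ G` SPLIT REGULAR: `γ = diag(z₀a, z₀b)`, `|z₀| = 1`, `a ≠ b`
real (every `diag(λ₁, λ₂) ∈ G` with `λ₁ ≠ λ₂` is of this form, `λ̄₁λ₂ = 1`), `T = G_γ` its centraliser (the split torus `{diag(λ, λ̄⁻¹)}`, §1: off-diagonal entries of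
`t ∈ T` vanish), `μ = quotientMeasure T ρ _ ν` the tree's invariant quotient measure (★ `IsQuotientOf` ∕ (W_H) token) for Haar measures `ν` on `G` (right and inversion
invariant — `G` is unimodular) and `ρ` on `T`.  CLAIM (`quotientMeasure_hsOrbitBall_le_sqrt_of_split`):
  `μ {x̄ ∣ Σ_ij |(x̄.out · γ · x̄.out⁻¹)_ij|² ≤ R} ≤ C · √R`   for all `R`, with `C = (κ_T⁻¹ c⁻¹ μ_{S¹}(S¹)) · 8π∕|a−b|`,
GIVEN the (T2e) identification `(lift)_*(μ_{S¹} ⊗ iwasawaMeasure) = c • ν` (`c ≠ 0`; ★ `archPlaneLiftUnitary`, the `S¹ × SL₂(ℝ) ↠ G` model of (T1); this is the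
uniqueness-of-Haar step inside ★ `haar_unitaryGroupOfForm_antidiag_two_hsBall_le`, taken here as the hypothesis `hν`).  PROOF = the `K·N` reading:
* §1 = ★ `ArchSplitTorusShell` (part 1, imported): `t ∈ T ⇒ t` diagonal, `χ(t) = |t₁₁|²` multiplicative, `(t g)₁ⱼ = t₁₁ g₁ⱼ`; by LEFT INVARIANCE of `ρ` alone the mass
  `κ_T(s) = ρ{t ∣ χ(t) ∈ [s, 2s]}` is independent of `s > 0` (`measure_chi_Icc_eq`); `κ_T = κ_T(1) ∈ (0, ∞)` (`measure_chi_Icc_ne_zero`, `measure_chi_Icc_lt_top`).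
* §2 the weight `ψ = κ_T⁻¹ · 1_{SLAB}`, `SLAB = {g ∣ ½ ≤ |g₁₀|² + |g₁₁|² ≤ 1}` (= `{1 ≤ y(r) ≤ 2}` under the lift, `y` = ★ `yOf`): its RIGHT `T`-fibres are
  `κ_T⁻¹ ρ{t ∣ χ(t)·s_g ∈ [½, 1]} = κ_T⁻¹ κ_T(1∕(2s_g)) = 1` (`lintegral_slabWeight_mul_eq_one`).
* §3 ★ `quotientMeasure_le_lintegral_inv_of_one_le` (p848769 §1): `μ(E_R) ≤ ∫_G 1_{E_R}(g⁻¹T) ψ(g) dν = κ_T⁻¹ · ν{g ∣ Σ|(g⁻¹γg)_ij|² ≤ R, g ∈ SLAB}`; under the lift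
  `g = z·D r D⁻¹` one has `Σ|(g⁻¹γg)_ij|² = Σ (r⁻¹ diag(a,b) r)_ij²` and `g ∈ SLAB ⟺ 1 ≤ y(r) ≤ 2` (`hs_conj_lift_eq`, `slab_lift_iff`), so by `hν` and ★
  `haarSL2pm_hsConjCone_slab_le` (p848769 §3: cone ∩ slab has `haarSL2pm`-volume `≤ 8π√R∕|a−b|`) the right side is `≤ κ_T⁻¹ c⁻¹ μ(S¹) · 8π√R∕|a−b|`.
ED. 2 (docstring-only): sub-locators re-pinned per lit4-(205)∕(210) L3-BP1∕L3-B2 (Beuzart-Plessis §1.8 p. 39, §1.2 (1.2.2)∕(1.2.4) p. 21; Borel §2.9); no statement or proof byte changed.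
HONEST LABEL: HC_CM is proved only modulo the 7 printed citations (2 remaining: hLiu418 = stmt-HodgeConjecture-24832, h413 = stmt-HodgeConjecture-24833) until rung 0
closes; this file closes no organ — it is the split-class half of (VOL) ⟹ (CONV), the A3-hardening of the LETTERS O1∕O3 (`stub_N9`) and O1″∕O3″ (`stub_N8`); the
instance hypotheses `[LocallyCompactSpace G] [SecondCountableTopology G]` are ★ `locallyCompactSpace_unitaryGroupOfForm_complex` ∕ `secondCountableTopology_…` at the
call site, `[ν.IsInvInvariant]` is ★ `isInvInvariant_of_isMulRightInvariant`.

## References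
* [BeuzartPlessis2020Asterisque] R. Beuzart-Plessis, *A local trace formula for the Gan–Gross–Prasad conjecture for unitary groups: the archimedean case*,
  Astérisque 418 (2020), §1.8 p. 39 (absolute convergence of Schwartz orbital integrals at regular semisimple elements); §1.2 (1.2.2), (1.2.4) p. 21 (orbit-norm equivalence, Harish-Chandra's estimate).
* [Folland1995] G. B. Folland, *A Course in Abstract Harmonic Analysis* (1995), §2.6 Thm. 2.49 (Weil's formula on `G ⧸ H`).
* [Borel1997] A. Borel, *Automorphic Forms on SL₂(ℝ)* (1997), §2.9 (Haar measures), §4.1 (1)–(3) (`SU(1,1)` model, Iwasawa Haar measure).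
-/

set_option autoImplicit false

noncomputable section

open Complex MeasureTheory Set Literature.MeasureTheory.Group Literature.NumberTheory.Automorphic Literature.NumberTheory.Automorphic.UnitaryGroup
open scoped Matrix ComplexConjugate NNReal ENNReal Real

namespace Literature.NumberTheory.Rogawski1990

/-! ## §2 Under the lift `g = z · D r D⁻¹`: `Σ|(g⁻¹ γ g)_ij|² = Σ (r⁻¹ diag(a,b) r)_ij²` and SLAB `⟺ 1 ≤ y(r) ≤ 2` -/

section Lift

variable {γ : ↥(unitaryGroupOfForm (starRingEnd ℂ) (Matrix.of fun i j : Fin 2 => if i.val + j.val + 1 = 2 then (1 : ℂ) else 0))} {z₀ : ℂ} {a b : ℝ}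

/-- The inverse of a lift: `(lift(z, r))⁻¹ = lift(z̄, adj r)` for `|z| = 1`, `det r = 1`. [cite: Borel1997, §4.1 (1)–(3)] -/
theorem inv_archPlaneLift_eq {z : ℂ} (hz : ‖z‖ = 1) {r : Matrix (Fin 2) (Fin 2) ℝ} (hr : r.det = 1) :
    (archPlaneLift z r)⁻¹ = archPlaneLift (conj z) r.adjugate := by
  apply Matrix.inv_eq_left_inv
  rw [← archPlaneLift_mul, Matrix.adjugate_mul, hr, one_smul, Complex.conj_mul', hz]
  norm_num
  exact archPlaneLift_one

/-- The split `γ = diag(z₀a, z₀b)` is itself a lift: `γ = lift(z₀, diag(a, b))`. [cite: Borel1997, §4.1 (1)–(3)] -/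
theorem diag_eq_archPlaneLift (z₀ : ℂ) (a b : ℝ) :
    (!![z₀ * a, 0; 0, z₀ * b] : Matrix (Fin 2) (Fin 2) ℂ) = archPlaneLift z₀ !![a, 0; 0, b] := by
  ext i j
  fin_cases i <;> fin_cases j <;> simp [archPlaneLift]

/-- **Hilbert–Schmidt norm of the conjugate under the lift**: for `g = lift(z, r)` (`|z| = 1`, `det r = 1`) and `γ = diag(z₀a, z₀b)` (`|z₀| = 1`),
`Σ_ij |(g⁻¹ γ g)_ij|² = Σ_ij ((r⁻¹ · diag(a,b) · r)_ij)²` — the `S¹`-factor is invisible and `D`-conjugation preserves entry moduli.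
[cite: BeuzartPlessis2020Asterisque, §1.8 p. 39; §1.2 (1.2.2), (1.2.4) p. 21] -/
theorem hs_conj_lift_eq (hγ : (((γ : ↥(unitaryGroupOfForm (starRingEnd ℂ) (Matrix.of fun i j : Fin 2 => if i.val + j.val + 1 = 2 then (1 : ℂ) else 0))) : GL (Fin 2) ℂ) : Matrix (Fin 2) (Fin 2) ℂ) = !![z₀ * a, 0; 0, z₀ * b]) (hz₀ : ‖z₀‖ = 1)
    (z : Circle) {r : Matrix (Fin 2) (Fin 2) ℝ} (hr : r.det = 1) :
    ∑ i : Fin 2, ∑ j : Fin 2, ‖((((archPlaneLiftUnitary (z, r))⁻¹ * γ * archPlaneLiftUnitary (z, r) : ↥(unitaryGroupOfForm (starRingEnd ℂ) (Matrix.of fun i j : Fin 2 => if i.val + j.val + 1 = 2 then (1 : ℂ) else 0))) : GL (Fin 2) ℂ) : Matrix (Fin 2) (Fin 2) ℂ) i j‖ ^ 2 =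
      ∑ i : Fin 2, ∑ j : Fin 2, (r⁻¹ * !![a, 0; 0, b] * r) i j ^ 2 := by
  have hz : ‖(z : ℂ)‖ = 1 := Circle.norm_coe z
  have hcoe : (((archPlaneLiftUnitary (z, r) : ↥(unitaryGroupOfForm (starRingEnd ℂ) (Matrix.of fun i j : Fin 2 => if i.val + j.val + 1 = 2 then (1 : ℂ) else 0))) : GL (Fin 2) ℂ) : Matrix (Fin 2) (Fin 2) ℂ) = archPlaneLift (z : ℂ) r :=
    coe_archPlaneLiftUnitary (p := (z, r)) hr
  have hmat : ((((archPlaneLiftUnitary (z, r))⁻¹ * γ * archPlaneLiftUnitary (z, r) : ↥(unitaryGroupOfForm (starRingEnd ℂ) (Matrix.of fun i j : Fin 2 => if i.val + j.val + 1 = 2 then (1 : ℂ) else 0))) : GL (Fin 2) ℂ) : Matrix (Fin 2) (Fin 2) ℂ) =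
      (archPlaneLift (z : ℂ) r)⁻¹ * !![z₀ * a, 0; 0, z₀ * b] * archPlaneLift (z : ℂ) r := by
    simp only [Subgroup.coe_mul, Subgroup.coe_inv, Units.val_mul, Matrix.coe_units_inv, hcoe, hγ]
  have hadj : r.adjugate = r⁻¹ := by rw [Matrix.inv_def, hr, Ring.inverse_one, one_smul]
  rw [hmat, inv_archPlaneLift_eq hz hr, diag_eq_archPlaneLift, ← archPlaneLift_mul, ← archPlaneLift_mul, hadj]
  have hw : ‖conj (z : ℂ) * z₀ * (z : ℂ)‖ = 1 := by
    rw [norm_mul, norm_mul, Complex.norm_conj, hz, hz₀]; norm_num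
  exact hs_archPlaneLift hw _

/-- The second row of a lift: `|g₁₀|² + |g₁₁|² = r₁₀² + r₁₁²` for `g = lift(z, r)`, `|z| = 1`, `det r = 1`. [cite: Borel1997, §4.1 (1)–(3)] -/
theorem normSq_row_one_lift (z : Circle) {r : Matrix (Fin 2) (Fin 2) ℝ} (hr : r.det = 1) :
    ‖(((archPlaneLiftUnitary (z, r) : ↥(unitaryGroupOfForm (starRingEnd ℂ) (Matrix.of fun i j : Fin 2 => if i.val + j.val + 1 = 2 then (1 : ℂ) else 0))) : GL (Fin 2) ℂ) : Matrix (Fin 2) (Fin 2) ℂ) 1 0‖ ^ 2 + ‖(((archPlaneLiftUnitary (z, r) : ↥(unitaryGroupOfForm (starRingEnd ℂ) (Matrix.of fun i j : Fin 2 => if i.val + j.val + 1 = 2 then (1 : ℂ) else 0))) : GL (Fin 2) ℂ) : Matrix (Fin 2) (Fin 2) ℂ) 1 1‖ ^ 2 = r 1 0 ^ 2 + r 1 1 ^ 2 := by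
  have hz : ‖(z : ℂ)‖ = 1 := Circle.norm_coe z
  rw [coe_archPlaneLiftUnitary (p := (z, r)) hr]
  simp [hz, Complex.norm_real, sq_abs]

/-- **SLAB ⟹ `1 ≤ y(r) ≤ 2`**: if `½ ≤ |g₁₀|² + |g₁₁|² ≤ 1` for `g = lift(z, r)` (`det r = 1`) then `1 ≤ y(r) ≤ 2` (`y(r) = det r ∕ (r₁₀² + r₁₁²)`, ★ `yOf`).
[cite: BeuzartPlessis2020Asterisque, §1.8 p. 39; §1.2 (1.2.2), (1.2.4) p. 21] -/
theorem yOf_mem_of_slab_lift (z : Circle) {r : Matrix (Fin 2) (Fin 2) ℝ} (hr : r.det = 1)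
    (h1 : 1 / 2 ≤ ‖(((archPlaneLiftUnitary (z, r) : ↥(unitaryGroupOfForm (starRingEnd ℂ) (Matrix.of fun i j : Fin 2 => if i.val + j.val + 1 = 2 then (1 : ℂ) else 0))) : GL (Fin 2) ℂ) : Matrix (Fin 2) (Fin 2) ℂ) 1 0‖ ^ 2 + ‖(((archPlaneLiftUnitary (z, r) : ↥(unitaryGroupOfForm (starRingEnd ℂ) (Matrix.of fun i j : Fin 2 => if i.val + j.val + 1 = 2 then (1 : ℂ) else 0))) : GL (Fin 2) ℂ) : Matrix (Fin 2) (Fin 2) ℂ) 1 1‖ ^ 2)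
    (h2 : ‖(((archPlaneLiftUnitary (z, r) : ↥(unitaryGroupOfForm (starRingEnd ℂ) (Matrix.of fun i j : Fin 2 => if i.val + j.val + 1 = 2 then (1 : ℂ) else 0))) : GL (Fin 2) ℂ) : Matrix (Fin 2) (Fin 2) ℂ) 1 0‖ ^ 2 + ‖(((archPlaneLiftUnitary (z, r) : ↥(unitaryGroupOfForm (starRingEnd ℂ) (Matrix.of fun i j : Fin 2 => if i.val + j.val + 1 = 2 then (1 : ℂ) else 0))) : GL (Fin 2) ℂ) : Matrix (Fin 2) (Fin 2) ℂ) 1 1‖ ^ 2 ≤ 1) :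
    1 ≤ yOf r ∧ yOf r ≤ 2 := by
  rw [normSq_row_one_lift z hr] at h1 h2
  have hs : 0 < r 1 0 ^ 2 + r 1 1 ^ 2 := lt_of_lt_of_le (by norm_num) h1
  unfold yOf
  rw [hr]
  refine ⟨one_le_one_div hs h2, ?_⟩
  rw [div_le_iff₀ hs]
  linarith

end Lift

/-! ## §3 The head: `μ_{G⧸T}{Σ|(x̄.out γ x̄.out⁻¹)_ij|² ≤ R} ≤ C √R` -/

section Head

/-- The orbit radius is constant on cosets: `Σ|((gT).out γ (gT).out⁻¹)_ij|² = Σ|(g γ g⁻¹)_ij|²` (`(gT).out = g t` with `t γ = γ t`).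
[cite: BeuzartPlessis2020Asterisque, §1.8 p. 39; §1.2 (1.2.2), (1.2.4) p. 21] -/
theorem hs_out_conj_eq (γ g : ↥(unitaryGroupOfForm (starRingEnd ℂ) (Matrix.of fun i j : Fin 2 => if i.val + j.val + 1 = 2 then (1 : ℂ) else 0))) :
    ∑ i : Fin 2, ∑ j : Fin 2, ‖((((QuotientGroup.mk g : ↥(unitaryGroupOfForm (starRingEnd ℂ) (Matrix.of fun i j : Fin 2 => if i.val + j.val + 1 = 2 then (1 : ℂ) else 0)) ⧸ Subgroup.centralizer ({γ} : Set ↥(unitaryGroupOfForm (starRingEnd ℂ) (Matrix.of fun i j : Fin 2 => if i.val + j.val + 1 = 2 then (1 : ℂ) else 0)))).out * γ * ((QuotientGroup.mk g : ↥(unitaryGroupOfForm (starRingEnd ℂ) (Matrix.of fun i j : Fin 2 => if i.val + j.val + 1 = 2 then (1 : ℂ) else 0)) ⧸ Subgroup.centralizer ({γ} : Set ↥(unitaryGroupOfForm (starRingEnd ℂ) (Matrix.of fun i j : Fin 2 => if i.val + j.val + 1 = 2 then (1 : ℂ) else 0)))).out)⁻¹ : ↥(unitaryGroupOfForm (starRingEnd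 ℂ) (Matrix.of fun i j : Fin 2 => if i.val + j.val + 1 = 2 then (1 : ℂ) else 0))) : GL (Fin 2) ℂ) : Matrix (Fin 2) (Fin 2) ℂ) i j‖ ^ 2 =
      ∑ i : Fin 2, ∑ j : Fin 2, ‖(((g * γ * g⁻¹ : ↥(unitaryGroupOfForm (starRingEnd ℂ) (Matrix.of fun i j : Fin 2 => if i.val + j.val + 1 = 2 then (1 : ℂ) else 0))) : GL (Fin 2) ℂ) : Matrix (Fin 2) (Fin 2) ℂ) i j‖ ^ 2 := by
  obtain ⟨t, ht⟩ := QuotientGroup.mk_out_eq_mul (Subgroup.centralizer ({γ} : Set ↥(unitaryGroupOfForm (starRingEnd ℂ) (Matrix.of fun i j : Fin 2 => if i.val + j.val + 1 = 2 then (1 : ℂ) else 0)))) g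
  have hc : (t : ↥(unitaryGroupOfForm (starRingEnd ℂ) (Matrix.of fun i j : Fin 2 => if i.val + j.val + 1 = 2 then (1 : ℂ) else 0))) * γ = γ * t := Subgroup.mem_centralizer_singleton_iff.1 t.2
  have e : (QuotientGroup.mk g : ↥(unitaryGroupOfForm (starRingEnd ℂ) (Matrix.of fun i j : Fin 2 => if i.val + j.val + 1 = 2 then (1 : ℂ) else 0)) ⧸ Subgroup.centralizer ({γ} : Set ↥(unitaryGroupOfForm (starRingEnd ℂ) (Matrix.of fun i j : Fin 2 => if i.val + j.val + 1 = 2 then (1 : ℂ) else 0)))).out * γ * ((QuotientGroup.mk g : ↥(unitaryGroupOfForm (starRingEnd ℂ) (Matrix.of fun i j : Fin 2 => if i.val + j.val + 1 = 2 then (1 : ℂ) else 0)) ⧸ Subgroup.centralizer ({γ} : Set ↥(unitaryGroupOfForm (starRingEnd ℂ) (Matrix.of fun i j : Fin 2 => if i.val + j.val + 1 = 2 then (1 : ℂ) else 0)))).out)⁻¹ = g * γ * g⁻¹ := by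
    rw [ht, mul_inv_rev, show g * (t : ↥(unitaryGroupOfForm (starRingEnd ℂ) (Matrix.of fun i j : Fin 2 => if i.val + j.val + 1 = 2 then (1 : ℂ) else 0))) * γ = g * (γ * t) by rw [mul_assoc, hc]]
    group
  rw [e]

variable [MeasurableSpace (Matrix (Fin 2) (Fin 2) ℝ)] [BorelSpace (Matrix (Fin 2) (Fin 2) ℝ)] [MeasurableSpace Circle] [BorelSpace Circle]
  [MeasurableSpace ↥(unitaryGroupOfForm (starRingEnd ℂ) (Matrix.of fun i j : Fin 2 => if i.val + j.val + 1 = 2 then (1 : ℂ) else 0))] [BorelSpace ↥(unitaryGroupOfForm (starRingEnd ℂ) (Matrix.of fun i j : Fin 2 => if i.val + j.val + 1 = 2 then (1 : ℂ) else 0))]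
  [LocallyCompactSpace ↥(unitaryGroupOfForm (starRingEnd ℂ) (Matrix.of fun i j : Fin 2 => if i.val + j.val + 1 = 2 then (1 : ℂ) else 0))] [SecondCountableTopology ↥(unitaryGroupOfForm (starRingEnd ℂ) (Matrix.of fun i j : Fin 2 => if i.val + j.val + 1 = 2 then (1 : ℂ) else 0))]

/-- **THE QUOTIENT VOLUME OF A SPLIT REGULAR ORBIT HS-BALL GROWS LIKE `√R`** (head (ii) of DEAL #11).  `G = U(Φ₂)(ℂ)`, `γ = diag(z₀a, z₀b)` split regular
(`|z₀| = 1`, `a ≠ b`), `T = G_γ`, `ν` a Haar measure on `G` (right and inversion invariant), `ρ` a Haar, inversion-invariant measure on `T`, `μ_{G⧸T} =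
quotientMeasure T ρ _ ν`; (T2e) HYPOTHESIS `hν`: the push-forward of `μ_c ⊗ iwasawaMeasure` along the `S¹ × SL₂(ℝ)` lift is `c • ν` (`c ≠ 0`, `μ_c` finite).  Then for
every `R`:  `μ_{G⧸T} {x̄ ∣ Σ_ij |(x̄.out γ x̄.out⁻¹)_ij|² ≤ R} ≤ (κ_T⁻¹ c⁻¹ μ_c(S¹)) · (8π∕|a−b|) · √R`, `κ_T = ρ{t ∣ |t₁₁|² ∈ [1,2]} ∈ (0, ∞)`.
Road: ★ `quotientMeasure_le_lintegral_inv_of_one_le` with the weight `κ_T⁻¹ 1_SLAB` (right fibres ≡ 1, §1), then `hν`, §2 and ★ `haarSL2pm_hsConjCone_slab_le`.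
[cite: BeuzartPlessis2020Asterisque, §1.8 p. 39; §1.2 (1.2.2), (1.2.4) p. 21] [cite: Folland1995, §2.6 Thm. 2.49] -/
theorem quotientMeasure_hsOrbitBall_le_sqrt_of_split
    {γ : ↥(unitaryGroupOfForm (starRingEnd ℂ) (Matrix.of fun i j : Fin 2 => if i.val + j.val + 1 = 2 then (1 : ℂ) else 0))} {z₀ : ℂ} {a b : ℝ} (hγ : (((γ : ↥(unitaryGroupOfForm (starRingEnd ℂ) (Matrix.of fun i j : Fin 2 => if i.val + j.val + 1 = 2 then (1 : ℂ) else 0))) : GL (Fin 2) ℂ) : Matrix (Fin 2) (Fin 2) ℂ) = !![z₀ * a, 0; 0, z₀ * b]) (hz₀ : ‖z₀‖ = 1) (hab : a ≠ b)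
    (ν : Measure ↥(unitaryGroupOfForm (starRingEnd ℂ) (Matrix.of fun i j : Fin 2 => if i.val + j.val + 1 = 2 then (1 : ℂ) else 0))) [ν.IsHaarMeasure] [ν.IsMulRightInvariant] [ν.IsInvInvariant]
    (ρ : Measure ↥(Subgroup.centralizer ({γ} : Set ↥(unitaryGroupOfForm (starRingEnd ℂ) (Matrix.of fun i j : Fin 2 => if i.val + j.val + 1 = 2 then (1 : ℂ) else 0))))) [ρ.IsHaarMeasure] [ρ.IsInvInvariant]
    [MeasurableSpace (↥(unitaryGroupOfForm (starRingEnd ℂ) (Matrix.of fun i j : Fin 2 => if i.val + j.val + 1 = 2 then (1 : ℂ) else 0)) ⧸ Subgroup.centralizer ({γ} : Set ↥(unitaryGroupOfForm (starRingEnd ℂ) (Matrix.of fun i j : Fin 2 => if i.val + j.val + 1 = 2 then (1 : ℂ) else 0))))] [BorelSpace (↥(unitaryGroupOfForm (starRingEnd ℂ) (Matrix.of fun i j : Fin 2 => if i.val + j.val + 1 = 2 then (1 : ℂ) else 0)) ⧸ Subgroup.centralizer ({γ} : Set ↥(unitaryGroupOfForm (starRingEnd ℂ) (Matrix.of fun i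 j : Fin 2 => if i.val + j.val + 1 = 2 then (1 : ℂ) else 0))))]
    (μc : Measure Circle) [IsFiniteMeasure μc] {c : ℝ≥0} (hc : c ≠ 0)
    (hν : Measure.map archPlaneLiftUnitary (μc.prod iwasawaMeasure) = c • ν) (R : ℝ) :
    quotientMeasure (Subgroup.centralizer ({γ} : Set ↥(unitaryGroupOfForm (starRingEnd ℂ) (Matrix.of fun i j : Fin 2 => if i.val + j.val + 1 = 2 then (1 : ℂ) else 0)))) ρ (Set.isClosed_centralizer ({γ} : Set ↥(unitaryGroupOfForm (starRingEnd ℂ) (Matrix.of fun i j : Fin 2 => if i.val + j.val + 1 = 2 then (1 : ℂ) else 0)))) ν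
        {x | ∑ i : Fin 2, ∑ j : Fin 2, ‖(((x.out * γ * x.out⁻¹ : ↥(unitaryGroupOfForm (starRingEnd ℂ) (Matrix.of fun i j : Fin 2 => if i.val + j.val + 1 = 2 then (1 : ℂ) else 0))) : GL (Fin 2) ℂ) : Matrix (Fin 2) (Fin 2) ℂ) i j‖ ^ 2 ≤ R} ≤
      ENNReal.ofReal (((ρ {t | ‖(((((t : ↥(Subgroup.centralizer ({γ} : Set ↥(unitaryGroupOfForm (starRingEnd ℂ) (Matrix.of fun i j : Fin 2 => if i.val + j.val + 1 = 2 then (1 : ℂ) else 0))))) : ↥(unitaryGroupOfForm (starRingEnd ℂ) (Matrix.of fun i j : Fin 2 => if i.val + j.val + 1 = 2 then (1 : ℂ) else 0))) : ↥(unitaryGroupOfForm (starRingEnd ℂ) (Matrix.of fun i j : Fin 2 => if i.val + j.val + 1 = 2 then (1 : ℂ) else 0))) : GL (Fin 2) ℂ) : Matrix (Fin 2) (Fin 2) ℂ) 1 1‖ ^ 2 ∈ Icc 1 2})⁻¹ * ((c : ℝ≥0∞))⁻¹ * μc univ).toReal * (8 * π / |a - b|) * Real.sqrt R) := by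
  haveI hT : IsClosed ((Subgroup.centralizer ({γ} : Set ↥(unitaryGroupOfForm (starRingEnd ℂ) (Matrix.of fun i j : Fin 2 => if i.val + j.val + 1 = 2 then (1 : ℂ) else 0)))) : Set ↥(unitaryGroupOfForm (starRingEnd ℂ) (Matrix.of fun i j : Fin 2 => if i.val + j.val + 1 = 2 then (1 : ℂ) else 0))) := Set.isClosed_centralizer _
  haveI : SFinite (iwasawaMeasure : Measure (Matrix (Fin 2) (Fin 2) ℝ)) := by
    unfold iwasawaMeasure; infer_instance
  have hz₀' : z₀ ≠ 0 := by
    intro h; rw [h, norm_zero] at hz₀; exact zero_ne_one hz₀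
  -- continuity of the matrix coefficients on `G`
  have hv : Continuous fun u : ↥(unitaryGroupOfForm (starRingEnd ℂ) (Matrix.of fun i j : Fin 2 => if i.val + j.val + 1 = 2 then (1 : ℂ) else 0)) => (((u : ↥(unitaryGroupOfForm (starRingEnd ℂ) (Matrix.of fun i j : Fin 2 => if i.val + j.val + 1 = 2 then (1 : ℂ) else 0))) : GL (Fin 2) ℂ) : Matrix (Fin 2) (Fin 2) ℂ) := Units.continuous_val.comp continuous_subtype_val
  have hent : ∀ i j : Fin 2, Continuous fun u : ↥(unitaryGroupOfForm (starRingEnd ℂ) (Matrix.of fun i j : Fin 2 => if i.val + j.val + 1 = 2 then (1 : ℂ) else 0)) => (((u : ↥(unitaryGroupOfForm (starRingEnd ℂ) (Matrix.of fun i j : Fin 2 => if i.val + j.val + 1 = 2 then (1 : ℂ) else 0))) : GL (Fin 2) ℂ) : Matrix (Fin 2) (Fin 2) ℂ) i j := fun i j => (continuous_apply j).comp ((continuous_apply i).comp hv)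
  -- the torus constant
  set κ : ℝ≥0∞ := ρ {t | ‖(((((t : ↥(Subgroup.centralizer ({γ} : Set ↥(unitaryGroupOfForm (starRingEnd ℂ) (Matrix.of fun i j : Fin 2 => if i.val + j.val + 1 = 2 then (1 : ℂ) else 0))))) : ↥(unitaryGroupOfForm (starRingEnd ℂ) (Matrix.of fun i j : Fin 2 => if i.val + j.val + 1 = 2 then (1 : ℂ) else 0))) : ↥(unitaryGroupOfForm (starRingEnd ℂ) (Matrix.of fun i j : Fin 2 => if i.val + j.val + 1 = 2 then (1 : ℂ) else 0))) : GL (Fin 2) ℂ) : Matrix (Fin 2) (Fin 2) ℂ) 1 1‖ ^ 2 ∈ Icc 1 2} with hκ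
  have hκ0 : κ ≠ 0 := measure_chi_Icc_ne_zero hγ ρ
  have hκtop : κ ≠ ⊤ := (measure_chi_Icc_lt_top hγ hz₀' hab ρ).ne
  -- the slab and the weight
  set SLAB : Set ↥(unitaryGroupOfForm (starRingEnd ℂ) (Matrix.of fun i j : Fin 2 => if i.val + j.val + 1 = 2 then (1 : ℂ) else 0)) := {g | 1 / 2 ≤ ‖(((g : ↥(unitaryGroupOfForm (starRingEnd ℂ) (Matrix.of fun i j : Fin 2 => if i.val + j.val + 1 = 2 then (1 : ℂ) else 0))) : GL (Fin 2) ℂ) : Matrix (Fin 2) (Fin 2) ℂ) 1 0‖ ^ 2 + ‖(((g : ↥(unitaryGroupOfForm (starRingEnd ℂ) (Matrix.of fun i j : Fin 2 => if i.val + j.val + 1 = 2 then (1 : ℂ) else 0))) : GL (Fin 2) ℂ) : Matrix (Fin 2) (Fin 2) ℂ) 1 1‖ ^ 2 ∧ ‖(((g : ↥(unitaryGroupOfForm (starRingEnd ℂ) (Matrix.of fun i j : Fin 2 => if i.val + j.val + 1 = 2 then (1 : ℂ) else 0))) : GL (Fin 2) ℂ) : Matrix (Fin 2) (Fin 2) ℂ)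 1 0‖ ^ 2 + ‖(((g : ↥(unitaryGroupOfForm (starRingEnd ℂ) (Matrix.of fun i j : Fin 2 => if i.val + j.val + 1 = 2 then (1 : ℂ) else 0))) : GL (Fin 2) ℂ) : Matrix (Fin 2) (Fin 2) ℂ) 1 1‖ ^ 2 ≤ 1} with hSLAB
  have hrow : Continuous fun g : ↥(unitaryGroupOfForm (starRingEnd ℂ) (Matrix.of fun i j : Fin 2 => if i.val + j.val + 1 = 2 then (1 : ℂ) else 0)) => ‖(((g : ↥(unitaryGroupOfForm (starRingEnd ℂ) (Matrix.of fun i j : Fin 2 => if i.val + j.val + 1 = 2 then (1 : ℂ) else 0))) : GL (Fin 2) ℂ) : Matrix (Fin 2) (Fin 2) ℂ) 1 0‖ ^ 2 + ‖(((g : ↥(unitaryGroupOfForm (starRingEnd ℂ) (Matrix.of fun i j : Fin 2 => if i.val + j.val + 1 = 2 then (1 : ℂ) else 0))) : GL (Fin 2) ℂ) : Matrix (Fin 2) (Fin 2) ℂ) 1 1‖ ^ 2 :=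
    (((hent 1 0).norm).pow 2).add (((hent 1 1).norm).pow 2)
  have hSLABm : MeasurableSet SLAB :=
    ((isClosed_le continuous_const hrow).inter (isClosed_le hrow continuous_const)).measurableSet
  set ψ : ↥(unitaryGroupOfForm (starRingEnd ℂ) (Matrix.of fun i j : Fin 2 => if i.val + j.val + 1 = 2 then (1 : ℂ) else 0)) → ℝ≥0∞ := fun g => κ⁻¹ * SLAB.indicator 1 g with hψ
  have hψm : Measurable ψ := measurable_const.mul (measurable_const.indicator hSLABm)
  -- RIGHT FIBRES OF THE WEIGHT ARE ONE
  have hfib : ∀ g : ↥(unitaryGroupOfForm (starRingEnd ℂ) (Matrix.of fun i j : Fin 2 => if i.val + j.val + 1 = 2 then (1 : ℂ) else 0)), 1 ≤ ∫⁻ t : ↥(Subgroup.centralizer ({γ} : Set ↥(unitaryGroupOfForm (starRingEnd ℂ) (Matrix.of fun i j : Fin 2 => if i.val + j.val + 1 = 2 then (1 : ℂ) else 0)))), ψ ((t : ↥(unitaryGroupOfForm (starRingEnd ℂ) (Matrix.of fun i j : Fin 2 => if i.val + j.val + 1 = 2 then (1 : ℂ) else 0))) * g) ∂ρ := by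
    intro g
    -- the second row of an invertible matrix is non-zero
    have hs : 0 < ‖(((g : ↥(unitaryGroupOfForm (starRingEnd ℂ) (Matrix.of fun i j : Fin 2 => if i.val + j.val + 1 = 2 then (1 : ℂ) else 0))) : GL (Fin 2) ℂ) : Matrix (Fin 2) (Fin 2) ℂ) 1 0‖ ^ 2 + ‖(((g : ↥(unitaryGroupOfForm (starRingEnd ℂ) (Matrix.of fun i j : Fin 2 => if i.val + j.val + 1 = 2 then (1 : ℂ) else 0))) : GL (Fin 2) ℂ) : Matrix (Fin 2) (Fin 2) ℂ) 1 1‖ ^ 2 := by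
      by_contra hle
      have h0 : ‖(((g : ↥(unitaryGroupOfForm (starRingEnd ℂ) (Matrix.of fun i j : Fin 2 => if i.val + j.val + 1 = 2 then (1 : ℂ) else 0))) : GL (Fin 2) ℂ) : Matrix (Fin 2) (Fin 2) ℂ) 1 0‖ ^ 2 + ‖(((g : ↥(unitaryGroupOfForm (starRingEnd ℂ) (Matrix.of fun i j : Fin 2 => if i.val + j.val + 1 = 2 then (1 : ℂ) else 0))) : GL (Fin 2) ℂ) : Matrix (Fin 2) (Fin 2) ℂ) 1 1‖ ^ 2 = 0 := le_antisymm (not_lt.1 hle) (by positivity)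
      have h10 : (((g : ↥(unitaryGroupOfForm (starRingEnd ℂ) (Matrix.of fun i j : Fin 2 => if i.val + j.val + 1 = 2 then (1 : ℂ) else 0))) : GL (Fin 2) ℂ) : Matrix (Fin 2) (Fin 2) ℂ) 1 0 = 0 := by
        have : ‖(((g : ↥(unitaryGroupOfForm (starRingEnd ℂ) (Matrix.of fun i j : Fin 2 => if i.val + j.val + 1 = 2 then (1 : ℂ) else 0))) : GL (Fin 2) ℂ) : Matrix (Fin 2) (Fin 2) ℂ) 1 0‖ ^ 2 = 0 := by nlinarith [sq_nonneg ‖(((g : ↥(unitaryGroupOfForm (starRingEnd ℂ) (Matrix.of fun i j : Fin 2 => if i.val + j.val + 1 = 2 then (1 : ℂ) else 0))) : GL (Fin 2) ℂ) : Matrix (Fin 2) (Fin 2) ℂ) 1 0‖, sq_nonneg ‖(((g : ↥(unitaryGroupOfForm (starRingEnd ℂ) (Matrix.of fun i j : Fin 2 => if i.val + j.val + 1 = 2 then (1 : ℂ) else 0))) : GL (Fin 2) ℂ) : Matrix (Fin 2) (Fin 2) ℂ) 1 1‖]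
        exact norm_eq_zero.1 (pow_eq_zero_iff two_ne_zero |>.1 this)
      have h11 : (((g : ↥(unitaryGroupOfForm (starRingEnd ℂ) (Matrix.of fun i j : Fin 2 => if i.val + j.val + 1 = 2 then (1 : ℂ) else 0))) : GL (Fin 2) ℂ) : Matrix (Fin 2) (Fin 2) ℂ) 1 1 = 0 := by
        have : ‖(((g : ↥(unitaryGroupOfForm (starRingEnd ℂ) (Matrix.of fun i j : Fin 2 => if i.val + j.val + 1 = 2 then (1 : ℂ) else 0))) : GL (Fin 2) ℂ) : Matrix (Fin 2) (Fin 2) ℂ) 1 1‖ ^ 2 = 0 := by nlinarith [sq_nonneg ‖(((g : ↥(unitaryGroupOfForm (starRingEnd ℂ) (Matrix.of fun i j : Fin 2 => if i.val + j.val + 1 = 2 then (1 : ℂ) else 0))) : GL (Fin 2) ℂ) : Matrix (Fin 2) (Fin 2) ℂ) 1 0‖, sq_nonneg ‖(((g : ↥(unitaryGroupOfForm (starRingEnd ℂ) (Matrix.of fun i j : Fin 2 => if i.val + j.val + 1 = 2 then (1 : ℂ) else 0))) : GL (Fin 2) ℂ) : Matrix (Fin 2) (Fin 2) ℂ) 1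 1‖]
        exact norm_eq_zero.1 (pow_eq_zero_iff two_ne_zero |>.1 this)
      have hdet : ((((g : ↥(unitaryGroupOfForm (starRingEnd ℂ) (Matrix.of fun i j : Fin 2 => if i.val + j.val + 1 = 2 then (1 : ℂ) else 0))) : GL (Fin 2) ℂ) : Matrix (Fin 2) (Fin 2) ℂ)).det ≠ 0 :=
        ((Matrix.isUnit_iff_isUnit_det _).1 (g : GL (Fin 2) ℂ).isUnit).ne_zero
      apply hdet
      rw [Matrix.det_fin_two, h10, h11, mul_zero, mul_zero, sub_zero]
    -- the fibre set is a `χ`-shell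
    set s : ℝ := ‖(((g : ↥(unitaryGroupOfForm (starRingEnd ℂ) (Matrix.of fun i j : Fin 2 => if i.val + j.val + 1 = 2 then (1 : ℂ) else 0))) : GL (Fin 2) ℂ) : Matrix (Fin 2) (Fin 2) ℂ) 1 0‖ ^ 2 + ‖(((g : ↥(unitaryGroupOfForm (starRingEnd ℂ) (Matrix.of fun i j : Fin 2 => if i.val + j.val + 1 = 2 then (1 : ℂ) else 0))) : GL (Fin 2) ℂ) : Matrix (Fin 2) (Fin 2) ℂ) 1 1‖ ^ 2 with hsdef
    have hpre : (fun t : ↥(Subgroup.centralizer ({γ} : Set ↥(unitaryGroupOfForm (starRingEnd ℂ) (Matrix.of fun i j : Fin 2 => if i.val + j.val + 1 = 2 then (1 : ℂ) else 0)))) => (t : ↥(unitaryGroupOfForm (starRingEnd ℂ) (Matrix.of fun i j : Fin 2 => if i.val + j.val + 1 = 2 then (1 : ℂ) else 0))) * g) ⁻¹' SLAB = {t | ‖(((((t : ↥(Subgroup.centralizer ({γ} : Set ↥(unitaryGroupOfForm (starRingEnd ℂ) (Matrix.of fun i j : Fin 2 => if i.val + j.val + 1 = 2 then (1 : ℂ)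 else 0))))) : ↥(unitaryGroupOfForm (starRingEnd ℂ) (Matrix.of fun i j : Fin 2 => if i.val + j.val + 1 = 2 then (1 : ℂ) else 0))) : ↥(unitaryGroupOfForm (starRingEnd ℂ) (Matrix.of fun i j : Fin 2 => if i.val + j.val + 1 = 2 then (1 : ℂ) else 0))) : GL (Fin 2) ℂ) : Matrix (Fin 2) (Fin 2) ℂ) 1 1‖ ^ 2 ∈ Icc (1 / (2 * s)) (2 * (1 / (2 * s)))} := by
      ext t
      simp only [Set.mem_preimage, hSLAB, Set.mem_setOf_eq, Set.mem_Icc]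
      have e10 : ‖(((((t : ↥(Subgroup.centralizer ({γ} : Set ↥(unitaryGroupOfForm (starRingEnd ℂ) (Matrix.of fun i j : Fin 2 => if i.val + j.val + 1 = 2 then (1 : ℂ) else 0))))) : ↥(unitaryGroupOfForm (starRingEnd ℂ) (Matrix.of fun i j : Fin 2 => if i.val + j.val + 1 = 2 then (1 : ℂ) else 0))) * g : ↥(unitaryGroupOfForm (starRingEnd ℂ) (Matrix.of fun i j : Fin 2 => if i.val + j.val + 1 = 2 then (1 : ℂ) else 0))) : GL (Fin 2) ℂ) : Matrix (Fin 2) (Fin 2) ℂ) 1 0‖ ^ 2 = ‖(((((t : ↥(Subgroup.centralizer ({γ} : Set ↥(unitaryGroupOfForm (starRingEnd ℂ) (Matrix.of fun i j : Fin 2 => if i.val + j.val + 1 = 2 then (1 : ℂ) else 0))))) : ↥(unitaryGroupOfForm (starRingEnd ℂ) (Matrix.of fun i j : Fin 2 => if i.val + j.val + 1 = 2 then (1 : ℂ) else 0))) : ↥(unitaryGroupOfForm (starRingEnd ℂ) (Matrix.of fun i j : Fin 2 => if i.val + j.val + 1 = 2 then (1 : ℂ) else 0))) : GL (Fin 2)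 ℂ) : Matrix (Fin 2) (Fin 2) ℂ) 1 1‖ ^ 2 * ‖(((g : ↥(unitaryGroupOfForm (starRingEnd ℂ) (Matrix.of fun i j : Fin 2 => if i.val + j.val + 1 = 2 then (1 : ℂ) else 0))) : GL (Fin 2) ℂ) : Matrix (Fin 2) (Fin 2) ℂ) 1 0‖ ^ 2 := by
        rw [mul_apply_one_of_mem_centralizer hγ hz₀' hab t.2 g 0, norm_mul, mul_pow]
      have e11 : ‖(((((t : ↥(Subgroup.centralizer ({γ} : Set ↥(unitaryGroupOfForm (starRingEnd ℂ) (Matrix.of fun i j : Fin 2 => if i.val + j.val + 1 = 2 then (1 : ℂ) else 0))))) : ↥(unitaryGroupOfForm (starRingEnd ℂ) (Matrix.of fun i j : Fin 2 => if i.val + j.val + 1 = 2 then (1 : ℂ) else 0))) * g : ↥(unitaryGroupOfForm (starRingEnd ℂ) (Matrix.of fun i j : Fin 2 => if i.val + j.val + 1 = 2 then (1 : ℂ) else 0))) : GL (Fin 2) ℂ) : Matrix (Fin 2) (Fin 2) ℂ) 1 1‖ ^ 2 = ‖(((((t : ↥(Subgroup.centralizer ({γ} : Set ↥(unitaryGroupOfForm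 (starRingEnd ℂ) (Matrix.of fun i j : Fin 2 => if i.val + j.val + 1 = 2 then (1 : ℂ) else 0))))) : ↥(unitaryGroupOfForm (starRingEnd ℂ) (Matrix.of fun i j : Fin 2 => if i.val + j.val + 1 = 2 then (1 : ℂ) else 0))) : ↥(unitaryGroupOfForm (starRingEnd ℂ) (Matrix.of fun i j : Fin 2 => if i.val + j.val + 1 = 2 then (1 : ℂ) else 0))) : GL (Fin 2) ℂ) : Matrix (Fin 2) (Fin 2) ℂ) 1 1‖ ^ 2 * ‖(((g : ↥(unitaryGroupOfForm (starRingEnd ℂ) (Matrix.of fun i j : Fin 2 => if i.val + j.val + 1 = 2 then (1 : ℂ) else 0))) : GL (Fin 2) ℂ) : Matrix (Fin 2) (Fin 2) ℂ) 1 1‖ ^ 2 := by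
        rw [mul_apply_one_of_mem_centralizer hγ hz₀' hab t.2 g 1, norm_mul, mul_pow]
      rw [e10, e11, ← mul_add, ← hsdef]
      have h2s : (2 * (1 / (2 * s))) = 1 / s := by field_simp
      rw [h2s]
      constructor
      · rintro ⟨h1, h2⟩
        exact ⟨by rw [div_le_iff₀ (by positivity)]; linarith, by rw [le_div_iff₀ hs]; linarith⟩
      · rintro ⟨h1, h2⟩
        rw [div_le_iff₀ (by positivity)] at h1
        rw [le_div_iff₀ hs] at h2
        exact ⟨by linarith, by linarith⟩
    have hpm : MeasurableSet ((fun t : ↥(Subgroup.centralizer ({γ} : Set ↥(unitaryGroupOfForm (starRingEnd ℂ) (Matrix.of fun i j : Fin 2 => if i.val + j.val + 1 = 2 then (1 : ℂ) else 0)))) => (t : ↥(unitaryGroupOfForm (starRingEnd ℂ) (Matrix.of fun i j : Fin 2 => if i.val + j.val + 1 = 2 then (1 : ℂ) else 0))) * g) ⁻¹' SLAB) :=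
      (continuous_subtype_val.mul continuous_const).measurable hSLABm
    have hind : (fun t : ↥(Subgroup.centralizer ({γ} : Set ↥(unitaryGroupOfForm (starRingEnd ℂ) (Matrix.of fun i j : Fin 2 => if i.val + j.val + 1 = 2 then (1 : ℂ) else 0)))) => SLAB.indicator (1 : ↥(unitaryGroupOfForm (starRingEnd ℂ) (Matrix.of fun i j : Fin 2 => if i.val + j.val + 1 = 2 then (1 : ℂ) else 0)) → ℝ≥0∞) ((t : ↥(unitaryGroupOfForm (starRingEnd ℂ) (Matrix.of fun i j : Fin 2 => if i.val + j.val + 1 = 2 then (1 : ℂ) else 0))) * g)) =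
        ((fun t : ↥(Subgroup.centralizer ({γ} : Set ↥(unitaryGroupOfForm (starRingEnd ℂ) (Matrix.of fun i j : Fin 2 => if i.val + j.val + 1 = 2 then (1 : ℂ) else 0)))) => (t : ↥(unitaryGroupOfForm (starRingEnd ℂ) (Matrix.of fun i j : Fin 2 => if i.val + j.val + 1 = 2 then (1 : ℂ) else 0))) * g) ⁻¹' SLAB).indicator 1 := by
      funext t
      by_cases ht : (t : ↥(unitaryGroupOfForm (starRingEnd ℂ) (Matrix.of fun i j : Fin 2 => if i.val + j.val + 1 = 2 then (1 : ℂ) else 0))) * g ∈ SLAB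
      · rw [Set.indicator_of_mem ht, Set.indicator_of_mem (show t ∈ (fun t : ↥(Subgroup.centralizer ({γ} : Set ↥(unitaryGroupOfForm (starRingEnd ℂ) (Matrix.of fun i j : Fin 2 => if i.val + j.val + 1 = 2 then (1 : ℂ) else 0)))) => (t : ↥(unitaryGroupOfForm (starRingEnd ℂ) (Matrix.of fun i j : Fin 2 => if i.val + j.val + 1 = 2 then (1 : ℂ) else 0))) * g) ⁻¹' SLAB from ht)]
        rfl
      · rw [Set.indicator_of_notMem ht, Set.indicator_of_notMem (show t ∉ (fun t : ↥(Subgroup.centralizer ({γ} : Set ↥(unitaryGroupOfForm (starRingEnd ℂ) (Matrix.of fun i j : Fin 2 => if i.val + j.val + 1 = 2 then (1 : ℂ) else 0)))) => (t : ↥(unitaryGroupOfForm (starRingEnd ℂ) (Matrix.of fun i j : Fin 2 => if i.val + j.val + 1 = 2 then (1 : ℂ) else 0))) * g) ⁻¹' SLAB from ht)]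
    have hcalc : ∫⁻ t : ↥(Subgroup.centralizer ({γ} : Set ↥(unitaryGroupOfForm (starRingEnd ℂ) (Matrix.of fun i j : Fin 2 => if i.val + j.val + 1 = 2 then (1 : ℂ) else 0)))), ψ ((t : ↥(unitaryGroupOfForm (starRingEnd ℂ) (Matrix.of fun i j : Fin 2 => if i.val + j.val + 1 = 2 then (1 : ℂ) else 0))) * g) ∂ρ = 1 := by
      have hmeas : Measurable (fun t : ↥(Subgroup.centralizer ({γ} : Set ↥(unitaryGroupOfForm (starRingEnd ℂ) (Matrix.of fun i j : Fin 2 => if i.val + j.val + 1 = 2 then (1 : ℂ) else 0)))) => SLAB.indicator (1 : ↥(unitaryGroupOfForm (starRingEnd ℂ) (Matrix.of fun i j : Fin 2 => if i.val + j.val + 1 = 2 then (1 : ℂ) else 0)) → ℝ≥0∞) ((t : ↥(unitaryGroupOfForm (starRingEnd ℂ) (Matrix.of fun i j : Fin 2 => if i.val + j.val + 1 = 2 then (1 : ℂ) else 0))) * g)) :=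
        (measurable_one.indicator hSLABm).comp (continuous_subtype_val.mul continuous_const).measurable
      simp only [hψ]
      rw [lintegral_const_mul _ hmeas, hind, lintegral_indicator_one hpm, hpre, measure_chi_Icc_eq hγ hz₀' hab ρ (by positivity : (0 : ℝ) < 1 / (2 * s)),
        ENNReal.inv_mul_cancel hκ0 hκtop]
    exact hcalc.symm.le
  -- THE ORBIT-BALL SET AND ITS MEASURABILITY
  set E : Set (↥(unitaryGroupOfForm (starRingEnd ℂ) (Matrix.of fun i j : Fin 2 => if i.val + j.val + 1 = 2 then (1 : ℂ) else 0)) ⧸ Subgroup.centralizer ({γ} : Set ↥(unitaryGroupOfForm (starRingEnd ℂ) (Matrix.of fun i j : Fin 2 => if i.val + j.val + 1 = 2 then (1 : ℂ) else 0)))) := {x | ∑ i : Fin 2, ∑ j : Fin 2, ‖(((x.out * γ * x.out⁻¹ : ↥(unitaryGroupOfForm (starRingEnd ℂ) (Matrix.of fun i j : Fin 2 => if i.val + j.val + 1 = 2 then (1 : ℂ) else 0))) : GL (Fin 2) ℂ) : Matrix (Fin 2) (Fin 2) ℂ) i j‖ ^ 2 ≤ R} with hE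
  have hHS : Continuous fun g : ↥(unitaryGroupOfForm (starRingEnd ℂ) (Matrix.of fun i j : Fin 2 => if i.val + j.val + 1 = 2 then (1 : ℂ) else 0)) => ∑ i : Fin 2, ∑ j : Fin 2, ‖(((g * γ * g⁻¹ : ↥(unitaryGroupOfForm (starRingEnd ℂ) (Matrix.of fun i j : Fin 2 => if i.val + j.val + 1 = 2 then (1 : ℂ) else 0))) : GL (Fin 2) ℂ) : Matrix (Fin 2) (Fin 2) ℂ) i j‖ ^ 2 := by
    have hc : Continuous fun g : ↥(unitaryGroupOfForm (starRingEnd ℂ) (Matrix.of fun i j : Fin 2 => if i.val + j.val + 1 = 2 then (1 : ℂ) else 0)) => (((g * γ * g⁻¹ : ↥(unitaryGroupOfForm (starRingEnd ℂ) (Matrix.of fun i j : Fin 2 => if i.val + j.val + 1 = 2 then (1 : ℂ) else 0))) : GL (Fin 2) ℂ) : Matrix (Fin 2) (Fin 2) ℂ) := hv.comp ((continuous_id.mul continuous_const).mul continuous_inv)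
    exact continuous_finsetSum _ fun i _ => continuous_finsetSum _ fun j _ => (((continuous_apply j).comp ((continuous_apply i).comp hc)).norm).pow 2
  have hHS' : Continuous fun g : ↥(unitaryGroupOfForm (starRingEnd ℂ) (Matrix.of fun i j : Fin 2 => if i.val + j.val + 1 = 2 then (1 : ℂ) else 0)) => ∑ i : Fin 2, ∑ j : Fin 2, ‖(((g⁻¹ * γ * g : ↥(unitaryGroupOfForm (starRingEnd ℂ) (Matrix.of fun i j : Fin 2 => if i.val + j.val + 1 = 2 then (1 : ℂ) else 0))) : GL (Fin 2) ℂ) : Matrix (Fin 2) (Fin 2) ℂ) i j‖ ^ 2 := by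
    have hc : Continuous fun g : ↥(unitaryGroupOfForm (starRingEnd ℂ) (Matrix.of fun i j : Fin 2 => if i.val + j.val + 1 = 2 then (1 : ℂ) else 0)) => (((g⁻¹ * γ * g : ↥(unitaryGroupOfForm (starRingEnd ℂ) (Matrix.of fun i j : Fin 2 => if i.val + j.val + 1 = 2 then (1 : ℂ) else 0))) : GL (Fin 2) ℂ) : Matrix (Fin 2) (Fin 2) ℂ) := hv.comp ((continuous_inv.mul continuous_const).mul continuous_id)
    exact continuous_finsetSum _ fun i _ => continuous_finsetSum _ fun j _ => (((continuous_apply j).comp ((continuous_apply i).comp hc)).norm).pow 2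
  have hEm : MeasurableSet E := by
    have hP : Measurable fun x : ↥(unitaryGroupOfForm (starRingEnd ℂ) (Matrix.of fun i j : Fin 2 => if i.val + j.val + 1 = 2 then (1 : ℂ) else 0)) ⧸ Subgroup.centralizer ({γ} : Set ↥(unitaryGroupOfForm (starRingEnd ℂ) (Matrix.of fun i j : Fin 2 => if i.val + j.val + 1 = 2 then (1 : ℂ) else 0))) => ∑ i : Fin 2, ∑ j : Fin 2, ‖(((x.out * γ * x.out⁻¹ : ↥(unitaryGroupOfForm (starRingEnd ℂ) (Matrix.of fun i j : Fin 2 => if i.val + j.val + 1 = 2 then (1 : ℂ) else 0))) : GL (Fin 2) ℂ) : Matrix (Fin 2) (Fin 2) ℂ) i j‖ ^ 2 := by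
      rw [measurable_quotient_iff (H := Subgroup.centralizer ({γ} : Set ↥(unitaryGroupOfForm (starRingEnd ℂ) (Matrix.of fun i j : Fin 2 => if i.val + j.val + 1 = 2 then (1 : ℂ) else 0)))) hT]
      have e : (fun x : ↥(unitaryGroupOfForm (starRingEnd ℂ) (Matrix.of fun i j : Fin 2 => if i.val + j.val + 1 = 2 then (1 : ℂ) else 0)) ⧸ Subgroup.centralizer ({γ} : Set ↥(unitaryGroupOfForm (starRingEnd ℂ) (Matrix.of fun i j : Fin 2 => if i.val + j.val + 1 = 2 then (1 : ℂ) else 0))) => ∑ i : Fin 2, ∑ j : Fin 2, ‖(((x.out * γ * x.out⁻¹ : ↥(unitaryGroupOfForm (starRingEnd ℂ) (Matrix.of fun i j : Fin 2 => if i.val + j.val + 1 = 2 then (1 : ℂ) else 0))) : GL (Fin 2) ℂ) : Matrix (Fin 2) (Fin 2) ℂ) i j‖ ^ 2) ∘ (QuotientGroup.mk : ↥(unitaryGroupOfForm (starRingEnd ℂ) (Matrix.of fun i j : Fin 2 => if i.val + j.val + 1 = 2 then (1 : ℂ) else 0)) → ↥(unitaryGroupOfForm (starRingEnd ℂ) (Matrix.of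 fun i j : Fin 2 => if i.val + j.val + 1 = 2 then (1 : ℂ) else 0)) ⧸ Subgroup.centralizer ({γ} : Set ↥(unitaryGroupOfForm (starRingEnd ℂ) (Matrix.of fun i j : Fin 2 => if i.val + j.val + 1 = 2 then (1 : ℂ) else 0)))) =
          fun g : ↥(unitaryGroupOfForm (starRingEnd ℂ) (Matrix.of fun i j : Fin 2 => if i.val + j.val + 1 = 2 then (1 : ℂ) else 0)) => ∑ i : Fin 2, ∑ j : Fin 2, ‖(((g * γ * g⁻¹ : ↥(unitaryGroupOfForm (starRingEnd ℂ) (Matrix.of fun i j : Fin 2 => if i.val + j.val + 1 = 2 then (1 : ℂ) else 0))) : GL (Fin 2) ℂ) : Matrix (Fin 2) (Fin 2) ℂ) i j‖ ^ 2 := by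
        funext g
        exact hs_out_conj_eq γ g
      rw [e]
      exact hHS.measurable
    exact measurableSet_le hP measurable_const
  -- STEP 1: the abstract unfolding bound with the weight `ψ`
  have step1 := quotientMeasure_le_lintegral_inv_of_one_le (Subgroup.centralizer ({γ} : Set ↥(unitaryGroupOfForm (starRingEnd ℂ) (Matrix.of fun i j : Fin 2 => if i.val + j.val + 1 = 2 then (1 : ℂ) else 0)))) ρ ν hEm hψm hfib
  -- STEP 2: the integrand is `κ⁻¹ · 1_{S'}`
  set S' : Set ↥(unitaryGroupOfForm (starRingEnd ℂ) (Matrix.of fun i j : Fin 2 => if i.val + j.val + 1 = 2 then (1 : ℂ) else 0)) := {g | ∑ i : Fin 2, ∑ j : Fin 2, ‖(((g⁻¹ * γ * g : ↥(unitaryGroupOfForm (starRingEnd ℂ) (Matrix.of fun i j : Fin 2 => if i.val + j.val + 1 = 2 then (1 : ℂ) else 0))) : GL (Fin 2) ℂ) : Matrix (Fin 2) (Fin 2) ℂ) i j‖ ^ 2 ≤ R} ∩ SLAB with hS'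
  have hS'm : MeasurableSet S' := (isClosed_le hHS' continuous_const).measurableSet.inter hSLABm
  have hint : ∫⁻ g, E.indicator 1 (QuotientGroup.mk g⁻¹ : ↥(unitaryGroupOfForm (starRingEnd ℂ) (Matrix.of fun i j : Fin 2 => if i.val + j.val + 1 = 2 then (1 : ℂ) else 0)) ⧸ Subgroup.centralizer ({γ} : Set ↥(unitaryGroupOfForm (starRingEnd ℂ) (Matrix.of fun i j : Fin 2 => if i.val + j.val + 1 = 2 then (1 : ℂ) else 0)))) * ψ g ∂ν = κ⁻¹ * ν S' := by
    have e : (fun g : ↥(unitaryGroupOfForm (starRingEnd ℂ) (Matrix.of fun i j : Fin 2 => if i.val + j.val + 1 = 2 then (1 : ℂ) else 0)) => E.indicator 1 (QuotientGroup.mk g⁻¹ : ↥(unitaryGroupOfForm (starRingEnd ℂ) (Matrix.of fun i j : Fin 2 => if i.val + j.val + 1 = 2 then (1 : ℂ) else 0)) ⧸ Subgroup.centralizer ({γ} : Set ↥(unitaryGroupOfForm (starRingEnd ℂ) (Matrix.of fun i j : Fin 2 => if i.val + j.val + 1 = 2 then (1 : ℂ) else 0)))) * ψ g) = fun g => κ⁻¹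 * S'.indicator 1 g := by
      funext g
      have hmem : ((QuotientGroup.mk g⁻¹ : ↥(unitaryGroupOfForm (starRingEnd ℂ) (Matrix.of fun i j : Fin 2 => if i.val + j.val + 1 = 2 then (1 : ℂ) else 0)) ⧸ Subgroup.centralizer ({γ} : Set ↥(unitaryGroupOfForm (starRingEnd ℂ) (Matrix.of fun i j : Fin 2 => if i.val + j.val + 1 = 2 then (1 : ℂ) else 0)))) ∈ E) ↔ ∑ i : Fin 2, ∑ j : Fin 2, ‖(((g⁻¹ * γ * g : ↥(unitaryGroupOfForm (starRingEnd ℂ) (Matrix.of fun i j : Fin 2 => if i.val + j.val + 1 = 2 then (1 : ℂ) else 0))) : GL (Fin 2) ℂ) : Matrix (Fin 2) (Fin 2) ℂ) i j‖ ^ 2 ≤ R := by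
        simp only [hE, Set.mem_setOf_eq]
        rw [hs_out_conj_eq γ g⁻¹, inv_inv]
      simp only [hψ]
      by_cases h1 : ∑ i : Fin 2, ∑ j : Fin 2, ‖(((g⁻¹ * γ * g : ↥(unitaryGroupOfForm (starRingEnd ℂ) (Matrix.of fun i j : Fin 2 => if i.val + j.val + 1 = 2 then (1 : ℂ) else 0))) : GL (Fin 2) ℂ) : Matrix (Fin 2) (Fin 2) ℂ) i j‖ ^ 2 ≤ R
      · by_cases h2 : g ∈ SLAB
        · rw [Set.indicator_of_mem (hmem.2 h1), Set.indicator_of_mem h2, Set.indicator_of_mem (show g ∈ S' from ⟨h1, h2⟩)]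
          simp
        · rw [Set.indicator_of_notMem h2, Set.indicator_of_notMem (show g ∉ S' from fun h => h2 h.2)]
          simp
      · rw [Set.indicator_of_notMem (fun h => h1 (hmem.1 h)), Set.indicator_of_notMem (show g ∉ S' from fun h => h1 h.1)]
        simp
    have hmeas : Measurable (S'.indicator (1 : ↥(unitaryGroupOfForm (starRingEnd ℂ) (Matrix.of fun i j : Fin 2 => if i.val + j.val + 1 = 2 then (1 : ℂ) else 0)) → ℝ≥0∞)) := measurable_one.indicator hS'm
    rw [e, lintegral_const_mul _ hmeas, lintegral_indicator_one hS'm]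
  -- STEP 3: (T2e) — `ν S' = c⁻¹ · (μ_c ⊗ iwasawa)(lift⁻¹ S')`
  have hνS : ν S' = ((c : ℝ≥0∞))⁻¹ * (μc.prod iwasawaMeasure) (archPlaneLiftUnitary ⁻¹' S') := by
    have h1 : Measure.map archPlaneLiftUnitary (μc.prod iwasawaMeasure) S' = (c : ℝ≥0∞) * ν S' := by
      rw [hν, Measure.smul_apply, ENNReal.smul_def, smul_eq_mul]
    rw [Measure.map_apply measurable_archPlaneLiftUnitary hS'm] at h1
    have hc' : (c : ℝ≥0∞) ≠ 0 := by exact_mod_cast hc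
    rw [h1, ← mul_assoc, ENNReal.inv_mul_cancel hc' ENNReal.coe_ne_top, one_mul]
  -- STEP 4: the preimage lies over the engine's cone ∩ slab (up to the null set `det r ≠ 1`)
  have hpre : (μc.prod iwasawaMeasure) (archPlaneLiftUnitary ⁻¹' S') ≤ μc univ * ENNReal.ofReal (8 * π * Real.sqrt R / |a - b|) := by
    set A : Set (Matrix (Fin 2) (Fin 2) ℝ) :=
      {r | r.det = 1 ∧ ∑ i : Fin 2, ∑ j : Fin 2, (r⁻¹ * !![a, 0; 0, b] * r) i j ^ 2 ≤ R ∧ 1 ≤ yOf r ∧ yOf r ≤ 2} with hA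
    calc (μc.prod iwasawaMeasure) (archPlaneLiftUnitary ⁻¹' S')
        ≤ (μc.prod iwasawaMeasure) ((univ : Set Circle) ×ˢ A ∪ (univ : Set Circle) ×ˢ {r : Matrix (Fin 2) (Fin 2) ℝ | r.det = 1}ᶜ) := by
          refine measure_mono fun p hp => ?_
          by_cases hdet : p.2.det = 1
          · left
            refine ⟨mem_univ _, hdet, ?_, ?_⟩
            · have h := hp.1
              simp only [Set.mem_setOf_eq] at h
              have hp' : p = (p.1, p.2) := rfl
              rw [hp', hs_conj_lift_eq hγ hz₀ p.1 hdet] at h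
              exact h
            · have h := hp.2
              simp only [hSLAB, Set.mem_setOf_eq] at h
              have hp' : p = (p.1, p.2) := rfl
              rw [hp'] at h
              exact yOf_mem_of_slab_lift p.1 hdet h.1 h.2
          · right
            exact ⟨mem_univ _, hdet⟩
      _ ≤ (μc.prod iwasawaMeasure) ((univ : Set Circle) ×ˢ A) + (μc.prod iwasawaMeasure) ((univ : Set Circle) ×ˢ {r : Matrix (Fin 2) (Fin 2) ℝ | r.det = 1}ᶜ) :=
          measure_union_le _ _
      _ = μc univ * iwasawaMeasure A := by
          rw [Measure.prod_prod, Measure.prod_prod, iwasawaMeasure_compl_det_one, mul_zero, add_zero]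
      _ ≤ μc univ * haarSL2pm A := mul_le_mul' le_rfl (iwasawaMeasure_le_haarSL2pm A)
      _ ≤ μc univ * ENNReal.ofReal (8 * π * Real.sqrt R / |a - b|) := mul_le_mul' le_rfl (haarSL2pm_hsConjCone_slab_le hab R)
  -- ASSEMBLY
  have hfin : κ⁻¹ * ((c : ℝ≥0∞))⁻¹ * μc univ ≠ ⊤ := by
    have hc' : (c : ℝ≥0∞) ≠ 0 := by exact_mod_cast hc
    exact ENNReal.mul_ne_top (ENNReal.mul_ne_top (ENNReal.inv_ne_top.2 hκ0) (ENNReal.inv_ne_top.2 hc')) (measure_ne_top μc _)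
  calc quotientMeasure (Subgroup.centralizer ({γ} : Set ↥(unitaryGroupOfForm (starRingEnd ℂ) (Matrix.of fun i j : Fin 2 => if i.val + j.val + 1 = 2 then (1 : ℂ) else 0)))) ρ (Set.isClosed_centralizer ({γ} : Set ↥(unitaryGroupOfForm (starRingEnd ℂ) (Matrix.of fun i j : Fin 2 => if i.val + j.val + 1 = 2 then (1 : ℂ) else 0)))) ν E
      ≤ ∫⁻ g, E.indicator 1 (QuotientGroup.mk g⁻¹ : ↥(unitaryGroupOfForm (starRingEnd ℂ) (Matrix.of fun i j : Fin 2 => if i.val + j.val + 1 = 2 then (1 : ℂ) else 0)) ⧸ Subgroup.centralizer ({γ} : Set ↥(unitaryGroupOfForm (starRingEnd ℂ) (Matrix.of fun i j : Fin 2 => if i.val + j.val + 1 = 2 then (1 : ℂ) else 0)))) * ψ g ∂ν := step1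
    _ = κ⁻¹ * ν S' := hint
    _ = κ⁻¹ * (((c : ℝ≥0∞))⁻¹ * (μc.prod iwasawaMeasure) (archPlaneLiftUnitary ⁻¹' S')) := by rw [hνS]
    _ ≤ κ⁻¹ * (((c : ℝ≥0∞))⁻¹ * (μc univ * ENNReal.ofReal (8 * π * Real.sqrt R / |a - b|))) := by gcongr
    _ = (κ⁻¹ * ((c : ℝ≥0∞))⁻¹ * μc univ) * ENNReal.ofReal (8 * π * Real.sqrt R / |a - b|) := by ring
    _ = ENNReal.ofReal ((κ⁻¹ * ((c : ℝ≥0∞))⁻¹ * μc univ).toReal * (8 * π / |a - b|) * Real.sqrt R) := by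
        rw [mul_assoc ((κ⁻¹ * ((c : ℝ≥0∞))⁻¹ * μc univ).toReal), ENNReal.ofReal_mul ENNReal.toReal_nonneg, ENNReal.ofReal_toReal hfin]
        congr 2
        ring

/-- **`∃ C, ∀ R, μ_{G⧸T}{orbit HS-ball ≤ R} ≤ C √R`** — the `hvol`-shaped corollary (exponent `e = ½`, no logarithm) for the (VOL) assembler.
[cite: BeuzartPlessis2020Asterisque, §1.8 p. 39; §1.2 (1.2.2), (1.2.4) p. 21] -/
theorem exists_quotientMeasure_hsOrbitBall_le_sqrt_of_split
    {γ : ↥(unitaryGroupOfForm (starRingEnd ℂ) (Matrix.of fun i j : Fin 2 => if i.val + j.val + 1 = 2 then (1 : ℂ) else 0))} {z₀ : ℂ} {a b : ℝ} (hγ : (((γ : ↥(unitaryGroupOfForm (starRingEnd ℂ) (Matrix.of fun i j : Fin 2 => if i.val + j.val + 1 = 2 then (1 : ℂ) else 0))) : GL (Fin 2) ℂ) : Matrix (Fin 2) (Fin 2) ℂ) = !![z₀ * a, 0; 0, z₀ * b]) (hz₀ : ‖z₀‖ = 1) (hab : a ≠ b)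
    (ν : Measure ↥(unitaryGroupOfForm (starRingEnd ℂ) (Matrix.of fun i j : Fin 2 => if i.val + j.val + 1 = 2 then (1 : ℂ) else 0))) [ν.IsHaarMeasure] [ν.IsMulRightInvariant] [ν.IsInvInvariant]
    (ρ : Measure ↥(Subgroup.centralizer ({γ} : Set ↥(unitaryGroupOfForm (starRingEnd ℂ) (Matrix.of fun i j : Fin 2 => if i.val + j.val + 1 = 2 then (1 : ℂ) else 0))))) [ρ.IsHaarMeasure] [ρ.IsInvInvariant]
    [MeasurableSpace (↥(unitaryGroupOfForm (starRingEnd ℂ) (Matrix.of fun i j : Fin 2 => if i.val + j.val + 1 = 2 then (1 : ℂ) else 0)) ⧸ Subgroup.centralizer ({γ} : Set ↥(unitaryGroupOfForm (starRingEnd ℂ) (Matrix.of fun i j : Fin 2 => if i.val + j.val + 1 = 2 then (1 : ℂ) else 0))))] [BorelSpace (↥(unitaryGroupOfForm (starRingEnd ℂ) (Matrix.of fun i j : Fin 2 => if i.val + j.val + 1 = 2 then (1 : ℂ) else 0)) ⧸ Subgroup.centralizer ({γ} : Set ↥(unitaryGroupOfForm (starRingEnd ℂ) (Matrix.of fun i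 j : Fin 2 => if i.val + j.val + 1 = 2 then (1 : ℂ) else 0))))]
    (μc : Measure Circle) [IsFiniteMeasure μc] {c : ℝ≥0} (hc : c ≠ 0)
    (hν : Measure.map archPlaneLiftUnitary (μc.prod iwasawaMeasure) = c • ν) :
    ∃ C : ℝ, ∀ R : ℝ, quotientMeasure (Subgroup.centralizer ({γ} : Set ↥(unitaryGroupOfForm (starRingEnd ℂ) (Matrix.of fun i j : Fin 2 => if i.val + j.val + 1 = 2 then (1 : ℂ) else 0)))) ρ (Set.isClosed_centralizer ({γ} : Set ↥(unitaryGroupOfForm (starRingEnd ℂ) (Matrix.of fun i j : Fin 2 => if i.val + j.val + 1 = 2 then (1 : ℂ) else 0)))) ν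
        {x | ∑ i : Fin 2, ∑ j : Fin 2, ‖(((x.out * γ * x.out⁻¹ : ↥(unitaryGroupOfForm (starRingEnd ℂ) (Matrix.of fun i j : Fin 2 => if i.val + j.val + 1 = 2 then (1 : ℂ) else 0))) : GL (Fin 2) ℂ) : Matrix (Fin 2) (Fin 2) ℂ) i j‖ ^ 2 ≤ R} ≤ ENNReal.ofReal (C * Real.sqrt R) :=
  ⟨_, quotientMeasure_hsOrbitBall_le_sqrt_of_split hγ hz₀ hab ν ρ μc hc hν⟩

end Head

end Literature.NumberTheory.Rogawski1990

end
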